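import Summits.HodgeConjecture.HodgeConjecture.Theorems.F0P6aStubRHO1Rho1Dock
import HarnessLib

/-!
# `F0P6aStubRHO1` — ★ RE-HOME of `Lines/F0_P6a_StubRHO1.lean` (tree sha16 ce86702e556aed39, 1561 l.), PART 6 of 6 — tree lines :1472–:1561 (LAST part: plain stem = the module the `Lines/` shim and every consumer import)
See PART 1 `Theorems/F0P6aStubRHO1K4Seam.lean` for the full ★ re-home header and the original module docstring (verbatim there).  Same namespace (every
fully-qualified name unchanged); the scopes open at the cut are re-opened below with their `variable` ∕ `open` ∕ `set_option` ∕ `universe` lines replayed verbatim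
from the tree, in order; the code after the replay block is the tree bytes :1472–:1561, untouched except the (d1) cure named in PART 1.  HC_CM is proved only modulo the 7 printed citations (2 remaining: hLiu418 = stmt-HodgeConjecture-24832, h413 = stmt-HodgeConjecture-24833) until rung 0 closes; a re-home is count-neutral.
-/

-- ── replay of the scopes open at tree line :1472 (verbatim) ──
set_option autoImplicit false
set_option linter.dupNamespace false
noncomputable section
namespace Summit.HodgeConjecture.HodgeConjecture.Cruxes.HLiu418.F0P6aLineSpecialisation
open CategoryTheory CategoryTheory.Limits NumberField IsDedekindDomain MulAction AlgebraicGeometry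
open scoped Matrix Polynomial Pointwise MonoidalCategory
open Literature.NumberTheory.GaloisRepresentations
open Literature.NumberTheory.Automorphic Literature.NumberTheory.Automorphic.UnitaryGroup
open Literature.AlgebraicGeometry.ShimuraVarieties.UnitaryCanonicalModel
open Literature.NumberTheory.Automorphic.Liu2021.AppendixC
open Literature.AlgebraicGeometry.Motives (AlgPoints IntegralModel SchemeOver thickening thickeningGalAction thickeningLift specOver extendPoint
  specValuationSubring specFractionFieldι specRingHomι)
open Literature.NumberTheory.EllipticCurves (genericFibre specGenericPoint)
open Literature.NumberTheory.DiophantineGeometry (geomResidueField specialFibreFunctor specResidueField geomClosedPointIsoSpecResidueField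
  toClosureValuationSubring)
open Literature.AlgebraicGeometry.RelativeSpec (ActionOver)
open Literature.AlgebraicGeometry.AbelianSchemes Literature.AlgebraicGeometry.AbelianSchemes.AbelianSchemeOver
open Literature.AlgebraicGeometry.GroupSchemes.AffineGroupScheme (Alg quotIncl)
open Summit.HodgeConjecture.HodgeConjecture.Cruxes.HLiu418.F0P6aModuliDatumDefs
open Summit.HodgeConjecture.HodgeConjecture.Cruxes.HLiu418.F0P6aRGDAssembly
open Summit.HodgeConjecture.HodgeConjecture.Cruxes.HLiu418.F0P6aDatumOfInputs
section Rho1Head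
open scoped MonObj CategoryTheory.Obj
variable {F : Type} [Field F] [NumberField F] [IsCMField F] [IsGalois ℚ F] {ι₁ : F →+* ℂ}
    {Jstar : Matrix (Fin 2) (Fin 2) F}
    {K₀ : C5.OpenCompactSubgroup ↥(finAdelic ↥(maximalRealSubfield F) F (IsCMField.complexConj F) 2 Jstar)}
    {S : RecordSystemGS F Jstar ι₁ K₀} {hU7ₛ : S.HeckeTranslateDefinedOver}
    {hJ : (Jstar.map (IsCMField.complexConj F))ᵀ = Jstar} {hJu : IsUnit Jstar}
    {Fi : Type} [Field Fi] [Algebra F Fi] {Kc : C5.SmallLevel K₀} {G : Type} [Group G]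
    {𝓜 : IntegralModel (𝓞 F) F ((thickening F Fi).obj (S.M.obj Kc))}
    {w : HeightOneSpectrum (𝓞 F)} {hw : (IsCMField.complexConj F) • w ≠ w} {h𝓨 : (𝓜.localise w).IsSmoothProper 1}
    {θ : ActionOver (𝓜.localise w).total.hom ((Fi ≃ₐ[F] Fi) × G)}
    {e : Fi →ₐ[F] AlgebraicClosure (w.adicCompletion F)}
set_option backward.isDefEq.respectTransparency false
set_option linter.unusedSectionVars false

set_option maxHeartbeats 400000 in
set_option backward.isDefEq.respectTransparency false in
/-- **(ρ1𝒞) HEAD `exists_quotLegReduction` — v3 = the `stub_RHO1` SOCKET TEXT OF RECORD (LA2-p04 (g2) `StubDOWN.leaf.ed4.cand.v2` be4dc9fa :1100–:1169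
VERBATIM; binder order LA2-plan (g2) 09:29:54Z (1); rows (FLAT-SURJ) ∧ (ACT) ∧ (LVL) ∧ (SIM) ∧ (K2-gen) ∧ (RK) ∧ (KILL) ∧ (DOCK) ∧ (IMG)-last).**  STATEMENT-FIRST: body
`sorry` until the rows are folded ((FLAT-SURJ)…(SIM)(K2-gen) ← §A (b′); (KILL) ← `KillCore` (LA1-p01 (g3)); (RK) ← ★ p850575; (DOCK) ← (KILL) + W7 §6; (IMG) ← §R `himg`).
[cite: Liu2021, p. 137] [cite: SerreTate1968, §1 Lemma 2] [cite: Tate1997FiniteFlatGroupSchemes, (3.7)] -/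
theorem exists_quotLegReduction (I : RGDInputsAt F ι₁ Jstar K₀ S hU7ₛ hJ hJu Fi Kc G 𝓜 w hw h𝓨 θ e) [ExpChar (geomResidueField w) I.pChar]
    (𝔡 : ∀ xbar, DockAt I xbar)
    -- SOCKET ORDER OF RECORD (LA2-plan (g2) 09:29:54Z (1)): `𝔡 quotΩ translΩ hhecke hroof hroof₂ hunit hKc`, THEN the Serre letters, THEN `(y) (L)`; no `hunr`∕`hpN` head binders
    (quotΩ : ∀ y, LineOf I y → AlgPoints (S.M.obj Kc) (AlgebraicClosure (w.adicCompletion F)))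
    (translΩ : AlgPoints (S.M.obj Kc) (AlgebraicClosure (w.adicCompletion F)) → AlgPoints (S.M.obj Kc) (AlgebraicClosure (w.adicCompletion F)))
    (_hhecke : HeckeClause I quotΩ translΩ) (_hroof : RoofLink I quotΩ) (_hroof₂ : RoofLink₂ I translΩ)
    (_hunit : (UnitaryGroup.isUnit_placeForm Jstar hJu w).unit ∈ glInt 2 (w.adicCompletion F))
    (_hKc : UnitaryGroup.IsHyperspecialAt ↥(maximalRealSubfield F) F (IsCMField.complexConj F) 2 Jstar Kc.1.1
      (w.under (𝓞 ↥(maximalRealSubfield F))))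
    {m : ℕ} (E' : Matrix (Fin m) (Fin m) (𝓞 F)) (hE' : E' * E' = E') (P : Matrix (Fin m) (Fin 1) (𝓞 F)) (Q : Matrix (Fin 1) (Fin m) (𝓞 F))
    (_hP : E' * P = P) (_hQ : Q * E' = Q) (_hQP : Q * P = Matrix.scalar (Fin 1) (I.pChar : 𝓞 F))
    (_hPQ : P * Q = Matrix.scalar (Fin m) (I.pChar : 𝓞 F) * E') (_h𝔭 : Ideal.span (Set.range fun k => P k 0) = w.asIdeal)
    (y : AlgPoints (S.M.obj Kc) (AlgebraicClosure (w.adicCompletion F))) (L : LineOf I y) :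
    haveI := I.comm
    letI := (𝔡 (red₀Of S Kc 𝓜 w h𝓨 e y)).grp₀
    haveI := (𝔡 (red₀Of S Kc 𝓜 w h𝓨 e y)).aff₀
      ∃ (ψ : (sch₀Of 𝓜 w I.univ (red₀Of S Kc 𝓜 w h𝓨 e y)).X ⟶ (sch₀Of 𝓜 w (serreTensor I.act E' hE') (red₀Of S Kc 𝓜 w h𝓨 e (quotΩ y L))).X) (_ : IsMonHom ψ),
        -- (FLAT-SURJ)
        (Flat ψ.left ∧ Function.Surjective ψ.left.base) ∧
        -- (ACT) `𝒪_F`-equivariance, `act₀Of` currency on both sides (`serreAction` on `𝒞`)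
        (∀ a : 𝓞 F, (act₀Of 𝓜 w I.univ I.act a (red₀Of S Kc 𝓜 w h𝓨 e y)).hom.hom.hom ≫ ψ =
          ψ ≫ (act₀Of 𝓜 w (serreTensor I.act E' hE') (serreAction I.act E' hE') a (red₀Of S Kc 𝓜 w h𝓨 e (quotΩ y L))).hom.hom.hom) ∧
        -- (LVL) level points: `ψ(σᵃ(x̄)) = (σᵃ ≫ ψ_P)(x̄″)`
        (∀ a : Fin I.g ⊕ Fin I.g → ZMod I.N,
          AlgPoints.map ψ (lvlPt₀Of 𝓜 w I.univ I.lvl (red₀Of S Kc 𝓜 w h𝓨 e y) a) =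
            ((serreTensor I.act E' hE').baseChange (pullback.fst (𝓜.localise w).total.hom (specResidueField w))).restrictPt (red₀Of S Kc 𝓜 w h𝓨 e (quotΩ y L)).left
              ((serreTensor I.act E' hE').sectionBaseChange (pullback.fst (𝓜.localise w).total.hom (specResidueField w)) (I.lvl.section_ a ≫ serreTranslate I.act E' hE' P))) ∧
        -- (SIM) for EVERY downstairs dual pair of `𝒞_{x̄″}` through which the cover leg pulls back to `λ ≫ [p]`: `ψ^* λ_B̄ = λ_{x̄} ≫ [p]`
        (∀ (DBs : (sch₀Of 𝓜 w (serreTensor I.act E' hE') (red₀Of S Kc 𝓜 w h𝓨 e (quotΩ y L))).DualPair)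
          (_ : Nonempty ((Scheme.Modules.pullback (DualPair.unitHatSlice DBs)).obj DBs.P ≅ SheafOfModules.unit _))
          (lamBs : (sch₀Of 𝓜 w (serreTensor I.act E' hE') (red₀Of S Kc 𝓜 w h𝓨 e (quotΩ y L))).X ⟶ DBs.hat.X) [IsMonHom lamBs],
          (haveI := isMonHom_coverLeg (pullback.fst (𝓜.localise w).total.hom (specResidueField w)) (red₀Of S Kc 𝓜 w h𝓨 e (quotΩ y L)).left I.act E' hE' P
           baseChangeHom (baseChangeHom (serreTranslate I.act E' hE' P) (pullback.fst (𝓜.localise w).total.hom (specResidueField w))) (red₀Of S Kc 𝓜 w h𝓨 e (quotΩ y L)).left ≫ lamBs ≫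
              DualPair.dualIsogenyOver (baseChangeHom (baseChangeHom (serreTranslate I.act E' hE' P) (pullback.fst (𝓜.localise w).total.hom (specResidueField w))) (red₀Of S Kc 𝓜 w h𝓨 e (quotΩ y L)).left)
                (dual₀Of 𝓜 w I.univ I.dual (red₀Of S Kc 𝓜 w h𝓨 e (quotΩ y L))) DBs =
            (pol₀Of 𝓜 w I.univ I.pol (red₀Of S Kc 𝓜 w h𝓨 e (quotΩ y L))).lam ≫ (dual₀Of 𝓜 w I.univ I.dual (red₀Of S Kc 𝓜 w h𝓨 e (quotΩ y L))).hat.mulN I.pChar) →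
          ψ ≫ lamBs ≫ DualPair.dualIsogenyOver ψ (dual₀Of 𝓜 w I.univ I.dual (red₀Of S Kc 𝓜 w h𝓨 e y)) DBs =
            (pol₀Of 𝓜 w I.univ I.pol (red₀Of S Kc 𝓜 w h𝓨 e y)).lam ≫ (dual₀Of 𝓜 w I.univ I.dual (red₀Of S Kc 𝓜 w h𝓨 e y)).hat.mulN I.pChar) ∧
        -- (K2-gen) every ideal bound on the kernel descends: `Ker q(Ω̄) ⊆ A_y[𝔞](Ω̄)` for the upstairs leg is recorded through `L`'s roof, so downstairs:
        (∀ 𝔞 : Ideal (𝓞 F), (∀ Pt ∈ L.1, IsIdealTorsionΩ S Kc 𝓜 w e I.univ I.act y 𝔞 Pt) →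
          (∀ Pt : (fibreΩOf S Kc 𝓜 w e I.univ y).Points (AlgebraicClosure (w.adicCompletion F)),
            (∀ r ∈ w.asIdeal * ((IsCMField.complexConj F) • w).asIdeal, (AlgPoints.map (actΩOf S Kc 𝓜 w e I.univ I.act r y).hom.hom.hom Pt :
              (fibreΩOf S Kc 𝓜 w e I.univ y).Points (AlgebraicClosure (w.adicCompletion F))) = 1) → IsIdealTorsionΩ S Kc 𝓜 w e I.univ I.act y 𝔞 Pt) →
          ∀ ⦃T : SchemeOver (geomResidueField w)⦄ (z : T ⟶ (sch₀Of 𝓜 w I.univ (red₀Of S Kc 𝓜 w h𝓨 e y)).X),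
            z ≫ ψ = 1 → ∀ r ∈ 𝔞, z ≫ (act₀Of 𝓜 w I.univ I.act r (red₀Of S Kc 𝓜 w h𝓨 e y)).hom.hom.hom = 1) ∧
        -- (RK) the rank of `Ker ψ`, BY VALUE for every closed realisation (LA2-p04 (g2) (C6′) `hrkᵢ` text)
        (∀ (K : SchemeOver (geomResidueField w)) [GrpObj K] [IsAffine K.left] [Module.Finite (geomResidueField w) (Alg K)]
          (κ : K ⟶ (sch₀Of 𝓜 w I.univ (red₀Of S Kc 𝓜 w h𝓨 e y)).X) [IsMonHom κ] [IsClosedImmersion κ.left],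
          (∀ ⦃T : SchemeOver (geomResidueField w)⦄ (t : T ⟶ (sch₀Of 𝓜 w I.univ (red₀Of S Kc 𝓜 w h𝓨 e y)).X), (∃ s : T ⟶ K, s ≫ κ = t) ↔ t ≫ ψ = 1) →
          Module.finrank (geomResidueField w) (Alg K) = I.pChar ^ I.fDeg * I.pChar ^ I.fDeg) ∧
        -- (KILL) `ψ` kills `V(spGeoOf y L) ↪ G₀(x̄) ↪ A_{x̄}`
        quotIncl (𝔡 (red₀Of S Kc 𝓜 w h𝓨 e y)).G₀ (spGeoOf I 𝔡 y L).1 ≫ (𝔡 (red₀Of S Kc 𝓜 w h𝓨 e y)).ι₀G ≫ ψ = 1 ∧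
        -- (DOCK) `Ker ψ ∩ G₀(x̄) = V(spGeoOf y L)` on all `T`-points of the dock
        (∀ ⦃T : SchemeOver (geomResidueField w)⦄ (t : T ⟶ (𝔡 (red₀Of S Kc 𝓜 w h𝓨 e y)).G₀),
          t ≫ (𝔡 (red₀Of S Kc 𝓜 w h𝓨 e y)).ι₀G ≫ ψ = 1 ↔
            ∃ s : T ⟶ specOver (geomResidueField w) (Alg (𝔡 (red₀Of S Kc 𝓜 w h𝓨 e y)).G₀ ⧸ (spGeoOf I 𝔡 y L).1),
              s ≫ quotIncl (𝔡 (red₀Of S Kc 𝓜 w h𝓨 e y)).G₀ (spGeoOf I 𝔡 y L).1 = t) ∧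
        -- (IMG) row, SHAPE (a) of record (LA2-plan (g2) 09:18:21Z (2)): the BACKTRACKING line `L_b` with `himg` (LA2-p03 (g3) f3424bb3 :279–:285 text at `H″ := spGeoOf I 𝔡 (quotΩ y L) L_b`)
        ∃ Lb : LineOf I (quotΩ y L), quotΩ (quotΩ y L) Lb = translΩ y ∧
          (letI := (𝔡 (red₀Of S Kc 𝓜 w h𝓨 e (quotΩ y L))).grp₀; haveI := (𝔡 (red₀Of S Kc 𝓜 w h𝓨 e (quotΩ y L))).aff₀;
            ∀ ⦃T : SchemeOver (geomResidueField w)⦄ (t : T ⟶ (𝔡 (red₀Of S Kc 𝓜 w h𝓨 e y)).G₀),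
              ∃ s : T ⟶ specOver (geomResidueField w) (Alg (𝔡 (red₀Of S Kc 𝓜 w h𝓨 e (quotΩ y L))).G₀ ⧸ (spGeoOf I 𝔡 (quotΩ y L) Lb).1),
                s ≫ quotIncl (𝔡 (red₀Of S Kc 𝓜 w h𝓨 e (quotΩ y L))).G₀ (spGeoOf I 𝔡 (quotΩ y L) Lb).1 ≫ (𝔡 (red₀Of S Kc 𝓜 w h𝓨 e (quotΩ y L))).ι₀G ≫
                    baseChangeHom (baseChangeHom (serreTranslate I.act E' hE' P) (pullback.fst (𝓜.localise w).total.hom (specResidueField w))) (red₀Of S Kc 𝓜 w h𝓨 e (quotΩ y L)).left =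
                  t ≫ (𝔡 (red₀Of S Kc 𝓜 w h𝓨 e y)).ι₀G ≫ ψ)
    := by
  -- (G1) the model-level unit pin of `I.dual` — NOT supplied by the socket (census 10:35Z); named gap
  -- v5: (G1) PAID — LA2-plan (g2) `hD_of_inputs` (§ROWS, BY COPY; served in `Lines/F0_P6a_SpecOrgansU.lean`)
  have hD : Nonempty ((Scheme.Modules.pullback (DualPair.unitHatSlice I.dual)).obj I.dual.P ≅ SheafOfModules.unit _) :=
    hD_of_inputs I
  -- destructure `RoofLink` ∕ `RoofΩ` by `Exists.elim` (no `cases` against this goal)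
  exact (_hroof y L).elim fun K hK => hK.2.elim fun B h => h.elim fun DB h => h.elim fun lamB h => h.elim fun hlamB h =>
    h.elim fun hDBu h => h.elim fun q h => h.elim fun hq h => h.elim fun c h => h.elim fun hc h =>
      haveI := hlamB
      haveI := hq
      haveI := hc
      exists_quotLegReduction_of_legs I 𝔡 quotΩ translΩ _hhecke _hroof _hroof₂ _hunit _hKc E' hE' P Q _hP _hQ _hQP _hPQ _h𝔭 y L
        hD K hK.1 hK.2 DB lamB hDBu q c h.1 h.2.1 h.2.2.1 h.2.2.2.1 h.2.2.2.2.1 h.2.2.2.2.2.1 h.2.2.2.2.2.2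

end Rho1Head

end Summit.HodgeConjecture.HodgeConjecture.Cruxes.HLiu418.F0P6aLineSpecialisation

end
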